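import Summits.KontsevichZagierPeriods.KontsevichZagierPeriods.Theorems.RootDecompRelativeModAbsoluteCircleLogP7

/-! # `RootDecompRelativeModAbsoluteCircleLogP8` — part 8/11 of the mechanical ≤400-line split of `CircleLogTranscendence_landing.lean` (sha256 022159109aaffa3a…)
Source: decomp-kz lens-3 g13 `CircleLogTranscendence_v9.lean` (HOME/decomp-kz-lens-3/g13/, sha256 afb45a43…; critic g5-45/60/65/68/69 CLEARED FOR LANDING --supports 30572 (§4 defs, §8–§10 CircleLogStructureAt 0 from the tree's baker_decomposition_complex, constant-data cells every n, §16–§23 descent ingredients); landed by census-1 g9 over the landed CylLogSplitP52 (BLOCK G13): the duplicate def CircleLogStructure is dropped in favour of the landed one).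
Split by census-1 g9 `gen/splitlean.py`: scopes re-opened with their `open`/`variable`/`set_option` context; mathematics and declaration order unchanged. -/

noncomputable section
open Set MeasureTheory Filter Topology
open scoped BigOperators
open Literature.NumberTheory.Transcendental Literature.ModelTheory.ExponentialFields
namespace Summit.KontsevichZagierPeriods.RootDecompRelativeModAbsolute.Rung30571.RegularisedLogLayer.CylLog.Leaf
open Set MeasureTheory Filter Topology in
open scoped BigOperators in
open Literature.NumberTheory.Transcendental Literature.ModelTheory.ExponentialFields in
/-- Real algebraic numbers are algebraic in `ℂ`. -/
private theorem isAlgebraic_ofReal {x : ℝ} (hx : IsAlgebraic ℚ x) : IsAlgebraic ℚ (x : ℂ) := by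
  simpa using hx.algebraMap (A := ℂ)

open Set MeasureTheory Filter Topology in
open scoped BigOperators in
open Literature.NumberTheory.Transcendental Literature.ModelTheory.ExponentialFields in
/-- `i` is algebraic. -/
private theorem isAlgebraic_I : IsAlgebraic ℚ Complex.I := by
  refine ⟨Polynomial.X ^ 2 + Polynomial.C 1, (Polynomial.monic_X_pow_add_C (1:ℚ) two_ne_zero).ne_zero, ?_⟩
  simp [Complex.I_sq]

namespace G13

/-- `CircleCellwiseFoldAt n ⟸ LogCellwiseFoldAt n ∧ AngleCellwiseFoldAt n` (the two band families fold separately; add). -/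
theorem circleCellwiseFoldAt_of_log_angle (n : ℕ) (hL : LogCellwiseFoldAt n) (hA : AngleCellwiseFoldAt n) :
    CircleCellwiseFoldAt n := by
  intro k l σ h W p u U A N C hσ hh hW hp hu hW1 hu0 hUd hUi hAd hAi hUint hAint hC hdisj hnull hcell
  refine KZ.relations.add_mem (hL k σ h W U N C hσ hh hW hW1 hUd hUi hUint hC hdisj hnull fun c => ?_)
    (hA l σ p u A N C hσ hp hu hu0 hAd hAi hAint hC hdisj hnull fun c => ?_)
  · obtain ⟨R, f, q, S, f', m, q', h1, h2, h3, -, -, -, -⟩ := hcell c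
    exact ⟨R, f, q, h1, h2, h3⟩
  · obtain ⟨R, f, q, S, f', m, q', -, -, -, h4, h5, h6, h7⟩ := hcell c
    exact ⟨S, f', m, q', h4, h5, h6, h7⟩

/-- Hence `CircleBoundaryRigidityAt n ⟸ CircleLogStructureAt n ∧ LogCellwiseFoldAt n ∧ AngleCellwiseFoldAt n`. -/
theorem circleBoundaryRigidityAt_of_CLS_logFold_angleFold (n : ℕ) (hCLS : CircleLogStructureAt n) (hL : LogCellwiseFoldAt n)
    (hA : AngleCellwiseFoldAt n) : CircleBoundaryRigidityAt n :=
  circleBoundaryRigidityAt_of_CLS_fold n hCLS (circleCellwiseFoldAt_of_log_angle n hL hA)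

/-! ### §16 CIRCLE CONSTANT-COEFFICIENT RIGIDITY — PROVED (the bottom of the descent for `CircleLogStructureMovingCirc`)

The tree proves `LogStructure` by a Kolchin–Ostrowski DESCENT (`stub_descent`: differentiate the identity along the cell, peel —
`stub_peelingStep` — until the coefficients are ALGEBRAIC CONSTANTS) down to `stub_constRigidity` (constant coefficients, MOVING `Wᵢ`:
pointwise Baker at the dense RATIONAL points, where all values are algebraic and the integer structure of the coefficient vector does not
depend on the point).  The same descent is the PLAN for `CircleLogStructureMovingCirc` (the extra terms `pⱼ arctan uⱼ` differentiate to
`pⱼ′ arctan uⱼ + pⱼ uⱼ′/(1+uⱼ²)`, the second summand `ℚ`-sa); its BOTTOM is proved here: `circleConstRigidity` — for constant algebraic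
coefficients the log relations and the angle relations DECOUPLE and the angle relations are EXACT (`Σ f′ arctan u ≡ 0`, no `π`). -/

open Summit.KontsevichZagierPeriods.LiouvilleUnfolding.LogPrimitiveNL in
/-- **Mixed Baker at a point**: for positive real algebraic `wᵢ`, real algebraic `vⱼ`, `ℚ`-free real algebraic families `β`, `β′`,
integer matrices `f`, `f′` and a real algebraic value
`G₀ = Σ_r β_r (Σᵢ f r i · log wᵢ) + Σ_s β′_s (Σⱼ f′ s j · arctan vⱼ)`, necessarily `G₀ = 0`, every `∏ wᵢ^{f r i} = 1` and every
`Σⱼ f′ s j · arctan vⱼ = 0` (complex Baker `constRig_baker_complex` — tree, crux LogPrimitiveNL — with the logarithms `Σ f log w` and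
`2i·Σ f′ arctan v` and the `ℚ`-free coefficient family `β ⊕ (−β′/2)·i`). -/
theorem mixedBaker_point {k l R S : ℕ} (w : Fin k → ℝ) (v : Fin l → ℝ) (β : Fin R → ℝ) (β' : Fin S → ℝ)
    (f : Fin R → Fin k → ℤ) (f' : Fin S → Fin l → ℤ) (G₀ : ℝ)
    (hw : ∀ i, 0 < w i) (hwalg : ∀ i, IsAlgebraic ℚ (w i)) (hvalg : ∀ j, IsAlgebraic ℚ (v j))
    (hβ : ∀ r, IsAlgebraic ℚ (β r)) (hβ' : ∀ s, IsAlgebraic ℚ (β' s)) (hβli : LinearIndependent ℚ β)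
    (hβ'li : LinearIndependent ℚ β') (hG : IsAlgebraic ℚ G₀)
    (hsum : ∑ r, β r * ∑ i, (f r i : ℝ) * Real.log (w i) +
      ∑ s, β' s * ∑ j, (f' s j : ℝ) * Real.arctan (v j) = G₀) :
    G₀ = 0 ∧ (∀ r, ∏ i, w i ^ (f r i) = 1) ∧ (∀ s, ∑ j, (f' s j : ℝ) * Real.arctan (v j) = 0) := by
  classical
  set L : Fin R → ℝ := fun r => ∑ i, (f r i : ℝ) * Real.log (w i) with hL
  set A : Fin S → ℝ := fun s => ∑ j, (f' s j : ℝ) * Real.arctan (v j) with hA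
  set lC : Fin (R + S) → ℂ :=
    Fin.append (fun r => ((L r : ℝ) : ℂ)) (fun s => (((2 * A s : ℝ)) : ℂ) * Complex.I) with hlC
  set βC : Fin (R + S) → ℂ :=
    Fin.append (fun r => ((β r : ℝ) : ℂ)) (fun s => (((-(β' s / 2) : ℝ)) : ℂ) * Complex.I) with hβC
  -- the product behind `L r`
  have hlogprod : ∀ r, Real.log (∏ i, w i ^ (f r i)) = L r := fun r => by
    rw [hL, Real.log_prod (fun i _ => (zpow_pos (hw i) _).ne')]
    exact Finset.sum_congr rfl fun i _ => Real.log_zpow _ _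
  have hprodpos : ∀ r, 0 < ∏ i, w i ^ (f r i) := fun r => Finset.prod_pos fun i _ => zpow_pos (hw i) _
  -- `exp` of every logarithm is algebraic
  have halg : ∀ m, IsAlgebraic ℚ (Complex.exp (lC m)) := by
    intro m
    refine Fin.addCases (fun r => ?_) (fun s => ?_) m
    · simp only [hlC, Fin.append_left]
      rw [← Complex.ofReal_exp, ← hlogprod r, Real.exp_log (hprodpos r)]
      refine isAlgebraic_ofReal ?_
      rw [← mem_algebraicClosure_iff]
      exact prod_mem fun i _ => zpow_mem (mem_algebraicClosure_iff.mpr (hwalg i)) _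
    · simp only [hlC, Fin.append_right]
      have hsplit : (((2 * A s : ℝ)) : ℂ) * Complex.I =
          ∑ j, (f' s j : ℂ) * ((((2 * Real.arctan (v j)) : ℝ) : ℂ) * Complex.I) := by
        rw [hA]; push_cast
        rw [Finset.mul_sum, Finset.sum_mul]
        exact Finset.sum_congr rfl fun j _ => by ring
      rw [hsplit, Complex.exp_sum, ← mem_algebraicClosure_iff]
      refine prod_mem fun j _ => ?_
      rw [Complex.exp_int_mul]
      exact zpow_mem (mem_algebraicClosure_iff.mpr (isAlgebraic_exp_two_arctan_mul_I (hvalg j))) _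
  have hβCalg : ∀ m, IsAlgebraic ℚ (βC m) := by
    intro m
    refine Fin.addCases (fun r => ?_) (fun s => ?_) m
    · simp only [hβC, Fin.append_left]; exact isAlgebraic_ofReal (hβ r)
    · simp only [hβC, Fin.append_right]
      refine (isAlgebraic_ofReal ?_).mul isAlgebraic_I
      have h2 : IsAlgebraic ℚ (2 : ℝ) := by simpa using isAlgebraic_nat (R := ℚ) (A := ℝ) 2
      rw [div_eq_mul_inv]; exact ((hβ' s).mul h2.inv).neg
  -- the relation, complexified
  have hsumC : ∑ m, βC m * lC m = (G₀ : ℂ) := by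
    rw [Fin.sum_univ_add]
    simp only [hβC, hlC, Fin.append_left, Fin.append_right]
    have h2 : ∀ s, (((-(β' s / 2) : ℝ)) : ℂ) * Complex.I * ((((2 * A s) : ℝ) : ℂ) * Complex.I) =
        ((β' s * A s : ℝ) : ℂ) := fun s => by
      push_cast; ring_nf; rw [Complex.I_sq]; ring
    rw [Finset.sum_congr rfl fun s _ => h2 s]
    have hsumR : ∑ r, β r * L r + ∑ s, β' s * A s = G₀ := hsum
    rw [← hsumR]
    push_cast
    ring
  -- the coefficient family is `ℚ`-free
  have hβCli : LinearIndependent ℚ βC := by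
    rw [Fintype.linearIndependent_iff]
    intro g hg
    rw [Fin.sum_univ_add] at hg
    simp only [hβC, Fin.append_left, Fin.append_right, Rat.smul_def] at hg
    have hre := congrArg Complex.re hg
    have him := congrArg Complex.im hg
    simp only [Complex.add_re, Complex.re_sum, Complex.mul_re, Complex.mul_im, Complex.ofReal_re,
      Complex.ofReal_im, Complex.I_re, Complex.I_im, Complex.ratCast_re, Complex.ratCast_im,
      Complex.add_im, Complex.im_sum, Complex.zero_re, Complex.zero_im, mul_zero, zero_mul, sub_zero,
      add_zero, zero_add, mul_one, sub_self, Finset.sum_const_zero] at hre him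
    -- hre : Σ r, g_r * β r = 0 ; him : Σ s, g_s * (-(β' s / 2)) = 0
    have h1 : ∀ r, g (Fin.castAdd S r) = 0 := by
      refine Fintype.linearIndependent_iff.mp hβli (fun r => g (Fin.castAdd S r)) ?_
      simpa [Rat.smul_def] using hre
    have h2 : ∀ s, g (Fin.natAdd R s) = 0 := by
      refine Fintype.linearIndependent_iff.mp hβ'li (fun s => g (Fin.natAdd R s)) ?_
      have : ∑ s, (g (Fin.natAdd R s) : ℝ) * β' s = (-2) * ∑ s, (g (Fin.natAdd R s) : ℝ) * (-(β' s / 2)) := by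
        rw [Finset.mul_sum]; exact Finset.sum_congr rfl fun s _ => by ring
      simp only [Rat.smul_def]
      rw [this, him, mul_zero]
    intro m
    exact Fin.addCases h1 h2 m
  obtain ⟨hG0, hall⟩ := constRig_baker_complex lC βC (G₀ : ℂ) halg hβCalg (isAlgebraic_ofReal hG) hsumC
  have hall' := hall hβCli
  refine ⟨by exact_mod_cast hG0, fun r => ?_, fun s => ?_⟩
  · have h := hall' (Fin.castAdd S r)
    simp only [hlC, Fin.append_left, Complex.ofReal_eq_zero] at h
    exact Real.eq_one_of_pos_of_log_eq_zero (hprodpos r) ((hlogprod r).trans h)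
  · have h := hall' (Fin.natAdd R s)
    simp only [hlC, Fin.append_right, mul_eq_zero, Complex.I_ne_zero, or_false, Complex.ofReal_eq_zero,
      mul_eq_zero, two_ne_zero, false_or] at h
    simpa [hA] using h

open Summit.KontsevichZagierPeriods.LiouvilleUnfolding.LogPrimitiveNL in
/-- **Circle constant-coefficient rigidity — PROVED** (the bottom of the would-be Kolchin–Ostrowski descent for the MIXED family, twin of
the tree's `stub_constRigidity`): an identity `Σ cᵢ log Wᵢ + Σ dⱼ arctan uⱼ = G` on an OPEN `D ⊆ ℝⁿ` with ALGEBRAIC CONSTANTS `cᵢ, dⱼ`,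
continuous positive `ℚ`-sa `Wᵢ`, continuous `ℚ`-sa `uⱼ` (MOVING data allowed) and continuous `ℚ`-sa `G` forces `G ≡ 0`,
`c = Σ_r β_r f_r` with EXACT multiplicative relations `∏ Wᵢ^{f r i} ≡ 1`, and — DECOUPLED — `d = Σ_s β′_s f′_s` with EXACT angle relations
`Σⱼ f′ s j · arctan uⱼ ≡ 0` on `D` (`β, β′` algebraic).  Proof = the tree's: `ℚ`-free integer structure of `c` and of `d`
(`constRig_exists_int_structure`), mixed Baker at every RATIONAL point of `D` (`mixedBaker_point`, values algebraic by
`constRig_isAlgebraic_apply_ratCast`), density + continuity (`constRig_eqOn_const_of_ratCast`). -/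
theorem circleConstRigidity (n k l : ℕ) (D : Set (Fin n → ℝ)) (c : Fin k → ℝ) (d : Fin l → ℝ)
    (W : Fin k → (Fin n → ℝ) → ℝ) (u : Fin l → (Fin n → ℝ) → ℝ) (G : (Fin n → ℝ) → ℝ)
    (hDo : IsOpen D) (hc : ∀ i, IsAlgebraic ℚ (c i)) (hd : ∀ j, IsAlgebraic ℚ (d j))
    (hW : ∀ i, IsSemialgebraicFunOn ℚ D (W i)) (hWc : ∀ i, ContinuousOn (W i) D)
    (hWpos : ∀ i, ∀ x ∈ D, 0 < W i x)
    (hu : ∀ j, IsSemialgebraicFunOn ℚ D (u j)) (huc : ∀ j, ContinuousOn (u j) D)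
    (hG : IsSemialgebraicFunOn ℚ D G) (hGc : ContinuousOn G D)
    (hsum : ∀ x ∈ D, ∑ i, c i * Real.log (W i x) + ∑ j, d j * Real.arctan (u j x) = G x) :
    (∀ x ∈ D, G x = 0) ∧
    (∃ (R : ℕ) (f : Fin R → Fin k → ℤ) (β : Fin R → ℝ), (∀ r, IsAlgebraic ℚ (β r)) ∧
      (∀ r, ∀ x ∈ D, ∏ i, W i x ^ (f r i) = 1) ∧ (∀ i, c i = ∑ r, β r * (f r i : ℝ))) ∧
    (∃ (S : ℕ) (f' : Fin S → Fin l → ℤ) (β' : Fin S → ℝ), (∀ s, IsAlgebraic ℚ (β' s)) ∧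
      (∀ s, ∀ x ∈ D, ∑ j, (f' s j : ℝ) * Real.arctan (u j x) = 0) ∧
      (∀ j, d j = ∑ s, β' s * (f' s j : ℝ))) := by
  classical
  obtain ⟨R, f, β, hβalg, hβli, hcf⟩ := constRig_exists_int_structure c hc
  obtain ⟨S, f', β', hβ'alg, hβ'li, hdf⟩ := constRig_exists_int_structure d hd
  have key : ∀ z : Fin n → ℚ, (fun i => (z i : ℝ)) ∈ D →
      G (fun i => (z i : ℝ)) = 0 ∧ (∀ r, ∏ i, W i (fun i => (z i : ℝ)) ^ (f r i) = 1) ∧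
        (∀ s, ∑ j, (f' s j : ℝ) * Real.arctan (u j fun i => (z i : ℝ)) = 0) := by
    intro z hz
    set x : Fin n → ℝ := fun i => (z i : ℝ) with hxdef
    have hwalg : ∀ i, IsAlgebraic ℚ (W i x) := fun i =>
      constRig_isAlgebraic_apply_ratCast n D (W i) z (hW i) hz
    have hvalg : ∀ j, IsAlgebraic ℚ (u j x) := fun j =>
      constRig_isAlgebraic_apply_ratCast n D (u j) z (hu j) hz
    have hGalg : IsAlgebraic ℚ (G x) := constRig_isAlgebraic_apply_ratCast n D G z hG hz
    refine mixedBaker_point (fun i => W i x) (fun j => u j x) β β' f f' (G x) (fun i => hWpos i x hz)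
      hwalg hvalg hβalg hβ'alg hβli hβ'li hGalg ?_
    rw [← hsum x hz]
    have e1 : ∑ r, β r * ∑ i, (f r i : ℝ) * Real.log (W i x) = ∑ i, c i * Real.log (W i x) := by
      calc ∑ r, β r * ∑ i, (f r i : ℝ) * Real.log (W i x)
            = ∑ i, (∑ r, β r * (f r i : ℝ)) * Real.log (W i x) := by
            simp_rw [Finset.mul_sum, Finset.sum_mul]
            rw [Finset.sum_comm]
            simp_rw [mul_assoc]
        _ = ∑ i, c i * Real.log (W i x) := Finset.sum_congr rfl fun i _ => by rw [← hcf i]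
    have e2 : ∑ s, β' s * ∑ j, (f' s j : ℝ) * Real.arctan (u j x) = ∑ j, d j * Real.arctan (u j x) := by
      calc ∑ s, β' s * ∑ j, (f' s j : ℝ) * Real.arctan (u j x)
            = ∑ j, (∑ s, β' s * (f' s j : ℝ)) * Real.arctan (u j x) := by
            simp_rw [Finset.mul_sum, Finset.sum_mul]
            rw [Finset.sum_comm]
            simp_rw [mul_assoc]
        _ = ∑ j, d j * Real.arctan (u j x) := Finset.sum_congr rfl fun j _ => by rw [← hdf j]
    rw [e1, e2]
  refine ⟨constRig_eqOn_const_of_ratCast hDo hGc 0 fun z hz => (key z hz).1,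
    ⟨R, f, β, hβalg, fun r => ?_, hcf⟩, ⟨S, f', β', hβ'alg, fun s => ?_, hdf⟩⟩
  · have hcont : ContinuousOn (fun x => ∏ i, W i x ^ (f r i)) D :=
      continuousOn_finsetProd _ fun i _ => (hWc i).zpow₀ _ fun x hx => Or.inl (hWpos i x hx).ne'
    exact constRig_eqOn_const_of_ratCast hDo hcont 1 fun z hz => (key z hz).2.1 r
  · have hcont : ContinuousOn (fun x => ∑ j, (f' s j : ℝ) * Real.arctan (u j x)) D :=
      continuousOn_finsetSum _ fun j _ =>
        continuousOn_const.mul (Real.continuous_arctan.comp_continuousOn (huc j))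
    exact constRig_eqOn_const_of_ratCast hDo hcont 0 fun z hz => (key z hz).2.2 s

/-! ### §17 The CONSTANT-COEFFICIENT case of the structure theorem for MOVING data — PROVED (first rung of the descent)

Complementary to §9 (constant DATA `Wᵢ,uⱼ`, moving coefficients): here the COEFFICIENTS `hᵢ,pⱼ` are constant and the data move.  One cell,
exact angle relations, constant algebraic `q, q′` (`isSemialgebraicFunOn_const_of_isAlgebraic`).  E.g. the moving identity
`arctan u + arctan((1−u)/(1+u)) − arctan 1 = 0` on `{−1 < u}` is covered (relation `f′ = (1,1,−1)`, exact). -/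

/-- **The CONSTANT-COEFFICIENT case of `CircleLogStructureAt n` — PROVED for MOVING data, every `n`** (from §16): if the `ℚ`-sa
coefficients `hᵢ`, `pⱼ` are constant on the open `ℚ`-sa `U` (the data `Wᵢ > 0`, `uⱼ` continuous `ℚ`-sa, otherwise arbitrary), the
structure conclusion holds for `U` with ONE cell, EXACT angle relations (`m ≡ 0`) and constant algebraic coefficients `q_r = β_r`, `q′_s = β′_s`.
The bottom rung of the descent planned for `CircleLogStructureMovingCirc`; complementary to §9 (constant DATA, moving coefficients). -/
theorem circleLogStructure_constCoeff {n k l : ℕ} {U : Set (Fin n → ℝ)} (hU : IsSemialgebraic ℚ U) (hUo : IsOpen U)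
    {h W : Fin k → (Fin n → ℝ) → ℝ} {p u : Fin l → (Fin n → ℝ) → ℝ} {g : (Fin n → ℝ) → ℝ}
    (hh : ∀ i, IsSemialgebraicFunOn ℚ U (h i)) (hW : ∀ i, IsSemialgebraicFunOn ℚ U (W i))
    (hWc : ∀ i, ContinuousOn (W i) U) (hW0 : ∀ i, ∀ x ∈ U, 0 < W i x)
    (hp : ∀ j, IsSemialgebraicFunOn ℚ U (p j)) (hu : ∀ j, IsSemialgebraicFunOn ℚ U (u j))
    (huc : ∀ j, ContinuousOn (u j) U) (hg : IsSemialgebraicFunOn ℚ U g)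
    (hhc : ∀ i, ∀ x ∈ U, ∀ y ∈ U, h i x = h i y) (hpc : ∀ j, ∀ x ∈ U, ∀ y ∈ U, p j x = p j y)
    (hid : ∀ x ∈ U, ∑ i, h i x * Real.log (W i x) + ∑ j, p j x * Real.arctan (u j x) = g x) :
    ∃ (N : ℕ) (C : Fin N → Set (Fin n → ℝ)),
      (∀ c, IsSemialgebraic ℚ (C c) ∧ IsOpen (C c) ∧ C c ⊆ U) ∧
      Pairwise (Function.onFun Disjoint C) ∧ volume (U \ ⋃ c, C c) = 0 ∧
      ∀ c, (∀ x ∈ C c, g x = 0) ∧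
        ∃ (R : ℕ) (f : Fin R → Fin k → ℤ) (q : Fin R → (Fin n → ℝ) → ℝ)
          (S : ℕ) (f' : Fin S → Fin l → ℤ) (m : Fin S → ℚ) (q' : Fin S → (Fin n → ℝ) → ℝ),
          (∀ r, IsSemialgebraicFunOn ℚ (C c) (q r)) ∧ (∀ r, ∀ x ∈ C c, ∏ i, W i x ^ (f r i) = 1) ∧
          (∀ i, ∀ x ∈ C c, h i x = ∑ r, q r x * (f r i : ℝ)) ∧
          (∀ s, IsSemialgebraicFunOn ℚ (C c) (q' s)) ∧
          (∀ s, ∀ x ∈ C c, ∑ j, (f' s j : ℝ) * Real.arctan (u j x) = (m s : ℝ) * Real.pi) ∧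
          (∀ x ∈ C c, ∑ s, q' s x * (m s : ℝ) = 0) ∧
          (∀ j, ∀ x ∈ C c, p j x = ∑ s, q' s x * (f' s j : ℝ)) := by
  classical
  rcases U.eq_empty_or_nonempty with hUe | hUne
  · refine ⟨0, Fin.elim0, fun c => c.elim0, fun c => c.elim0, ?_, fun c => c.elim0⟩
    simp [hUe]
  obtain ⟨x₀, hx₀, hx₀alg⟩ := algebraicPoints U hU hUne
  set c : Fin k → ℝ := fun i => h i x₀ with hc_def
  set d : Fin l → ℝ := fun j => p j x₀ with hd_def
  have hc : ∀ i, IsAlgebraic ℚ (c i) := fun i => (hh i).isAlgebraic_apply hx₀ hx₀alg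
  have hd : ∀ j, IsAlgebraic ℚ (d j) := fun j => (hp j).isAlgebraic_apply hx₀ hx₀alg
  have hhx : ∀ i, ∀ x ∈ U, h i x = c i := fun i x hx => hhc i x hx x₀ hx₀
  have hpx : ∀ j, ∀ x ∈ U, p j x = d j := fun j x hx => hpc j x hx x₀ hx₀
  have hid' : ∀ x ∈ U, ∑ i, c i * Real.log (W i x) + ∑ j, d j * Real.arctan (u j x) = g x := by
    intro x hx
    rw [← hid x hx]
    congr 1
    · exact Finset.sum_congr rfl fun i _ => by rw [hhx i x hx]
    · exact Finset.sum_congr rfl fun j _ => by rw [hpx j x hx]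
  have hgc : ContinuousOn g U := by
    have hc' : ContinuousOn (fun x => ∑ i, c i * Real.log (W i x) + ∑ j, d j * Real.arctan (u j x)) U :=
      (continuousOn_finsetSum _ fun i _ =>
          continuousOn_const.mul ((hWc i).log fun x hx => (hW0 i x hx).ne')).add
        (continuousOn_finsetSum _ fun j _ =>
          continuousOn_const.mul (Real.continuous_arctan.comp_continuousOn (huc j)))
    exact hc'.congr fun x hx => (hid' x hx).symm
  obtain ⟨hG0, ⟨R, f, β, hβ, hrel, hcf⟩, ⟨S, f', β', hβ', hrel', hdf⟩⟩ :=
    circleConstRigidity n k l U c d W u g hUo hc hd hW hWc hW0 hu huc hg hgc hid'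
  have hnull : volume (U \ ⋃ _ : Fin 1, U) = 0 := by
    rw [Set.iUnion_const]; simp
  refine ⟨1, fun _ => U, fun _ => ⟨hU, hUo, subset_rfl⟩, fun a b hab => absurd (Subsingleton.elim a b) hab,
    hnull, fun _ => ⟨hG0, R, f, fun r _ => β r, S, f', fun _ => 0, fun s _ => β' s,
      fun r => isSemialgebraicFunOn_const_of_isAlgebraic hU (hβ r), hrel, fun i x hx => ?_,
      fun s => isSemialgebraicFunOn_const_of_isAlgebraic hU (hβ' s), fun s x hx => ?_, fun x _ => by simp,
      fun j x hx => ?_⟩⟩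
  · rw [hhx i x hx]; exact hcf i
  · rw [hrel' s x hx]; simp
  · rw [hpx j x hx]; exact hdf j

/-! ### §18 Projectively constant coefficients (case (a) of the descent step) — PROVED -/

end G13
end Summit.KontsevichZagierPeriods.RootDecompRelativeModAbsolute.Rung30571.RegularisedLogLayer.CylLog.Leaf
end
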